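/-
Copyright: the b2b-balaban cell (near-miss cell 7), T⁴-continuum fan-out; row NE7b ROUND-2 swarm, seat
t4-ne7b-formalise-leaf-05 gen 4 (row S6g′ INSTANCE of `t4/b2b-balaban-t4-ne7b-p1/LEAVES-NE7b.md`, owner's rulings
R-OWNER-22-23∕-24 and ACK l.12945: T3a part 3 «laws», file B1).  Released under the licence of the surrounding project.
-/
import Summits.QuantumFields.BalabanUV.T4Continuum.Support.HistoryJoinsPlacedZone
import Summits.QuantumFields.BalabanUV.T4Continuum.Support.HistoryZoneMassBridge

/-!
# The concrete zone `zoneP` on TAGGED SUB-STRUCTURES: relative placements, the cluster-contact binder, the root block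
# (row S6g′ INSTANCE, T3a part 3 «laws», file B1 «TAGGED»)

Summits-side support leaf of the T⁴-continuum cell (rung (B)+1 on a FINITE torus only; NOT infinite volume, NOT the
mass gap, NOT the Clay statement; NOT a proof of the spine estimate NE7b).  Row NE7b, route «COUNT», row S6g′.
[folklore] finite tree bookkeeping + torus geometry over the lineage's own carriers; composition BY NAME of leaf-04
gen 3's bridge (`HistoryZoneMassBridge.hconn_of_cadm`), gen 2's address tags (`HistoryJoinsTag.cadm_addrTag` ∕
`zone_part_eq_zf` ∕ `zf`) and file A's zone (`HistoryJoinsPlacedZone.zoneP` ∕ `regOf`).  Nothing is quoted from print,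
nothing printed is asserted, no `[cite:]` tag, no `Prop` fact minted, no definition.

WHAT.  For the zone `zoneP n L K lv c c₀ t Z p` of file A (the levelled region reading of the address-tagged tree
`addrTag [] Z` under the region map `regOf c₀ p` of a placement `p : Addr D → TCell d (n·L^K) × Template d M`):
* §1 a sub-structure of a tagged tree is a tagged sub-structure (`exists_addrTag_of_sub`); `Chrono`, `ftime`, `zmass`
  under tags; the core zone ∕ region reading of a tagged sub-structure under the whole placement IS its reading under
  the relative placement (`coreZoneD_regOf_addrTag`, `regZoneD_regOf_addrTag`); gen 2's displayed part zone `zf` of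
  `zoneP` lies INSIDE the region reading (`zf_zoneP_subset`) — whence **`hconn_zoneP`**: the count's canonical
  admissibility `CAdm (zoneP …) ρ c₀ step Z p` and a dating of `Z` give leaf-04 gen 3's cluster-contact binder `hconn`
  of `card_regZoneD_le_pieces` for the region map `regOf c₀ p` on `addrTag [] Z`;
* §2 bookkeeping: cluster parts and joins are sub-structures (`sub_of_mem_clusterParts`, `sub_of_mem_crootsP`,
  `sub_of_mem_joins`, `sub_of_mem_tparts`), sub-structures of dated structures are dated (`dated_of_sub`), merge nodes
  happen no later than the dating step (`step_le_of_dated_sub`), renewal-blindness of `Sany` and `OK`;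
* §3 the root cell's level-`t` block lies in the region reading at every `t ≥ ftime` with `lv t ≤ K`
  (`blk_mem_regOf`: templates contain the origin; `root_blk_mem_regZoneD`).
File B2 (`HistoryJoinsPlacedLaws`) turns these into the END's binders `hlawM`∕`hlawC` for `zoneP`.

HONEST SCOPE.  Bookkeeping∕geometry over OUR carriers; the identification of Bałaban's regions with the reading stays
H3; nothing of H3∕(B)∕BetaPertH touched; `BirthShapeNodup` NOT retired here; NE7b NOT proved.  HONEST DEPENDENCY
(cell): continuum YM on T⁴ ⇐ BetaPertH ∧ nine spine estimates (0/9 proved); BetaPertH ⇐ (D1) ∧ (D4) ∧ CAP+tail;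
G-an2-4 gates asym, D1 and NE2/3/4.  This file changes none of it.
-/

open Finset
open Literature.MathematicalPhysics.QuantumFieldTheory.Balaban1983to89
open Literature.MathematicalPhysics.QuantumFieldTheory.Balaban1983to89.B13ScaleTransfer (Pt)
open T4PersistenceDictionary T4PartnerMultiplicity T4BranchingRecordsGas
open Summit.QuantumFields.BalabanUV.T4Continuum.PlacementSkeleton
open Summit.QuantumFields.BalabanUV.T4Continuum.ZoneTorus
open Summit.QuantumFields.BalabanUV.T4Continuum.ZoneSkeleton
open Summit.QuantumFields.BalabanUV.T4Continuum.HistoryZones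
open Summit.QuantumFields.BalabanUV.T4Continuum.HistoryZoneMass
open Summit.QuantumFields.BalabanUV.T4Continuum.HistoryZoneEvolve
open Summit.QuantumFields.BalabanUV.T4Continuum.HistoryZoneEvolveLevels
open Summit.QuantumFields.BalabanUV.T4Continuum.HistoryZoneMassLaw
open Summit.QuantumFields.BalabanUV.T4Continuum.HistoryZoneMassJoins
open Summit.QuantumFields.BalabanUV.T4Continuum.HistoryZoneMassPieces
open Summit.QuantumFields.BalabanUV.T4Continuum.HistoryZoneMassCluster
open Summit.QuantumFields.BalabanUV.T4Continuum.HistoryZoneMassBridge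
open Summit.QuantumFields.BalabanUV.T4Continuum.HistoryJoins
open Summit.QuantumFields.BalabanUV.T4Continuum.HistoryJoinsAdm
open Summit.QuantumFields.BalabanUV.T4Continuum.HistoryJoinsTag
open Summit.QuantumFields.BalabanUV.T4Continuum.HistoryJoinsSupTorus
open Summit.QuantumFields.BalabanUV.T4Continuum.HistoryJoinsSupExtent
open Summit.QuantumFields.BalabanUV.T4Continuum.HistoryRegionTemplates
open Summit.QuantumFields.BalabanUV.T4Continuum.HistoryJoinsTemplates
open Summit.QuantumFields.BalabanUV.T4Continuum.HistoryJoinsPlacedZone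

namespace Summit.QuantumFields.BalabanUV.T4Continuum.HistoryJoinsPlacedTagged

noncomputable section

open scoped Classical

/-! ## §1 Tagged sub-structures; the region map under relative placement; the cluster-contact binder -/

section Tagged

variable {ε : Type*}

/-- **A SUB-STRUCTURE OF A TAGGED TREE IS A TAGGED SUB-STRUCTURE** (prefix extended by its address). [folklore] -/
theorem exists_addrTag_of_sub : ∀ {a : List Bool} {G : Gen ε} {W : Gen (List Bool × ε)},
    Sub W (addrTag a G) → ∃ l W₀, Sub W₀ G ∧ W = addrTag (a ++ l) W₀
  | a, Gen.born b j, W, hS => by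
      rw [addrTag_born] at hS
      cases hS with
      | refl => exact ⟨[], Gen.born b j, Sub.refl _, by simp⟩
  | a, Gen.renew G e h, W, hS => by
      rw [addrTag_renew] at hS
      cases hS with
      | refl => exact ⟨[], Gen.renew G e h, Sub.refl _, by simp⟩
      | renew _ _ hs =>
          obtain ⟨l, W₀, h0, rfl⟩ := exists_addrTag_of_sub hs
          exact ⟨l, W₀, Sub.renew e h h0, rfl⟩
  | a, Gen.merge X Y e, W, hS => by
      rw [addrTag_merge] at hS
      cases hS with
      | refl => exact ⟨[], Gen.merge X Y e, Sub.refl _, by simp⟩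
      | left _ _ hs =>
          obtain ⟨l, W₀, h0, rfl⟩ := exists_addrTag_of_sub hs
          exact ⟨false :: l, W₀, Sub.left Y e h0, by simp⟩
      | right _ _ hs =>
          obtain ⟨l, W₀, h0, rfl⟩ := exists_addrTag_of_sub hs
          exact ⟨true :: l, W₀, Sub.right X e h0, by simp⟩

/-- untagging by `gmap` [folklore] -/
theorem gmap_snd_addrTag : ∀ (a : List Bool) (G : Gen ε), gmap Prod.snd (addrTag a G) = G
  | a, Gen.born b j => rfl
  | a, Gen.renew G e h => by rw [addrTag_renew, gmap, gmap_snd_addrTag a G]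
  | a, Gen.merge X Y e => by rw [addrTag_merge, gmap, gmap_snd_addrTag _ X, gmap_snd_addrTag _ Y]

/-- chronology transports to the tagged tree [folklore] -/
theorem chrono_addrTag [DecidableEq ε] (st : ε → ℕ) {G : Gen ε} (h : Chrono st G) (a : List Bool) :
    Chrono (st ∘ Prod.snd) (addrTag a G) :=
  chrono_of_gmap Prod.snd st (by rw [gmap_snd_addrTag]; exact h)

/-- the formation time of the tagged tree [folklore] -/
theorem ftime_addrTag (st : ε → ℕ) : ∀ (a : List Bool) (G : Gen ε), ftime (st ∘ Prod.snd) (addrTag a G) = ftime st G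
  | _, Gen.born _ _ => rfl
  | a, Gen.renew G _ _ => ftime_addrTag st a G
  | _, Gen.merge _ _ _ => rfl

/-- the tagged tree of a birth or a merger is not a renewal [folklore] -/
theorem addrTag_ne_renew {G : Gen ε} (hG : ∀ (Y : Gen ε) (e : ε) (h : ℕ), G ≠ Gen.renew Y e h) (a : List Bool) :
    ∀ (W : Gen (List Bool × ε)) (r : List Bool × ε) (h : ℕ), addrTag a G ≠ Gen.renew W r h := by
  intro W r h
  cases G with
  | born b j => simp
  | renew Y e k => exact absurd rfl (hG Y e k)
  | merge X Y e => simp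

end Tagged

variable {d n L K D M : ℕ} {lv : ℕ → ℕ} {c : ℕ} {c₀ : TCell d (n * L ^ K) × Template d M}
  {p : Addr D → TCell d (n * L ^ K) × Template d M}

/-- the decayed mass is blind to the address tags [folklore] -/
theorem zmass_addrTag (θ WB WM : ℝ) (t : ℕ) : ∀ (a : List Bool) (G : Gen PEv),
    zmass Prod.snd θ WB WM t (addrTag a G) = zmass (id : PEv → PEv) θ WB WM t G
  | a, Gen.born b j => by simp [zmass]
  | a, Gen.renew G e h => by rw [addrTag_renew, zmass, zmass]; exact zmass_addrTag θ WB WM t a G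
  | a, Gen.merge X Y e => by
      rw [addrTag_merge, zmass, zmass, zmass_addrTag θ WB WM t _ X, zmass_addrTag θ WB WM t _ Y]; rfl

/-- the region map of a relatively placed sub-structure reads the whole placement at the shifted tag [folklore] -/
theorem regOf_rel (a l : List Bool) (b : PEv) :
    regOf n L K lv c₀ (rel c₀ a p) (l, b) = regOf n L K lv c₀ p (a ++ l, b) := by
  simp only [regOf, evalA_rel]

/-- **THE CORE ZONE OF A TAGGED SUB-STRUCTURE UNDER THE WHOLE PLACEMENT IS ITS CORE ZONE UNDER THE RELATIVE
PLACEMENT.** [folklore] -/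
theorem coreZoneD_regOf_addrTag (t : ℕ) : ∀ (a : List Bool) (p : Addr D → TCell d (n * L ^ K) × Template d M)
    (W : Gen PEv),
    coreZoneD Prod.snd L lv (regOf n L K lv c₀ p) t (addrTag a W) =
      coreZoneD Prod.snd L lv (regOf n L K lv c₀ (rel c₀ a p)) t (addrTag [] W)
  | a, p, Gen.born b j => by
      have h : regOf n L K lv c₀ (rel c₀ a p) ([], b) = regOf n L K lv c₀ p (a, b) := by
        rw [regOf_rel, List.append_nil]
      simp [coreZoneD, h]
  | a, p, Gen.renew W e h => by
      rw [addrTag_renew, addrTag_renew, coreZoneD_renew, coreZoneD_renew]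
      exact coreZoneD_regOf_addrTag t a p W
  | a, p, Gen.merge X Y e => by
      rw [addrTag_merge, addrTag_merge, coreZoneD_merge, coreZoneD_merge, List.nil_append, List.nil_append,
        coreZoneD_regOf_addrTag t (a ++ [false]) p X, coreZoneD_regOf_addrTag t (a ++ [true]) p Y,
        coreZoneD_regOf_addrTag t [false] (rel c₀ a p) X, coreZoneD_regOf_addrTag t [true] (rel c₀ a p) Y,
        rel_append, rel_append]

/-- … the same for the levelled region reading [folklore] -/
theorem regZoneD_regOf_addrTag (t : ℕ) (a : List Bool) (p : Addr D → TCell d (n * L ^ K) × Template d M)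
    (W : Gen PEv) :
    regZoneD Prod.snd n L K lv c (regOf n L K lv c₀ p) t (addrTag a W) =
      regZoneD Prod.snd n L K lv c (regOf n L K lv c₀ (rel c₀ a p)) t (addrTag [] W) := by
  unfold regZoneD
  rw [coreZoneD_regOf_addrTag t a p W]

/-- **THE COUNT's DISPLAYED PART ZONE LIES IN THE REGION READING**: gen 2's part-zone function `zf` of `zoneP` at a
tagged sub-structure is the region reading of that sub-structure under the whole placement, or empty. [folklore] -/
theorem zf_zoneP_subset (t : ℕ) (l : List Bool) (W₀ : Gen PEv) (p : Addr D → TCell d (n * L ^ K) × Template d M) :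
    zf (zoneP n L K lv c c₀) c₀ p t (addrTag l W₀) ⊆
      regZoneD Prod.snd n L K lv c (regOf n L K lv c₀ p) t (addrTag l W₀) := by
  simp only [zf, untag_addrTag, pref_addrTag]
  unfold zoneP
  split_ifs with h
  · rw [regZoneD_regOf_addrTag t l p W₀]
  · exact empty_subset _

variable {R : Type*} [LinearOrder R] (ρ : (Addr D → TCell d (n * L ^ K) × Template d M) → R)

/-- **FROM CANONICAL ADMISSIBILITY OF THE PLACEMENT TO CLUSTER CONTACT OF THE REGION READING** (leaf-04 gen 3's binder
`hconn` of `card_regZoneD_le_pieces` for `reg := regOf c₀ p` on the tagged tree `addrTag [] Z`): the count's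
`CAdm (zoneP …) ρ c₀ step Z p` and a dating of `Z`. [folklore] -/
theorem hconn_zoneP {Z : Gen PEv} (hadm : CAdm (zoneP n L K lv c c₀) ρ c₀ PEv.step Z p) {s₀ : Bool} {T : ℕ}
    (hD : Dated PEv.step s₀ T Z) :
    ∀ (t₀ : ℕ) (Y W : Gen (List Bool × PEv)) (e : List Bool × PEv),
      Gen.merge Y W e ∈ parts Prod.snd t₀ (addrTag [] Z) →
        TConn (fun a b => (regZoneD Prod.snd n L K lv c (regOf n L K lv c₀ p) (Prod.snd e).step a ∩
            regZoneD Prod.snd n L K lv c (regOf n L K lv c₀ p) (Prod.snd e).step b).Nonempty)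
          (parts Prod.snd (Prod.snd e).step (Gen.merge Y W e)) := by
  intro t₀ Y W e hM
  have hadmT : CAdm (zoneT (zoneP n L K lv c c₀)) ρ c₀ (PEv.step ∘ Prod.snd) (addrTag [] Z) p :=
    cadm_addrTag PEv.step (zoneP n L K lv c c₀) ρ c₀ hadm []
  have hDT : Dated (PEv.step ∘ Prod.snd) s₀ T (addrTag [] Z) := (dated_addrTag PEv.step s₀ T [] Z).2 hD
  have h := hconn_of_cadm (sh := (Prod.snd : List Bool × PEv → PEv)) hadmT hDT (zf (zoneP n L K lv c c₀) c₀ p)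
    (fun t Y r h => zf_renew (zoneP n L K lv c c₀) c₀ (fun t Y r h q => zoneP_renew t Y r h) p t Y r h)
    (fun q hq i => zone_part_eq_zf PEv.step (zoneP n L K lv c c₀) c₀ Z p q hq _ i) t₀ Y W e hM
  refine h.mono fun a ha b hb hab => ?_
  obtain ⟨la, a₀, -, rfl⟩ :=
    exists_addrTag_of_sub (Sub.trans (sub_of_mem_parts _ ha) (sub_of_mem_parts t₀ hM))
  obtain ⟨lb, b₀, -, rfl⟩ :=
    exists_addrTag_of_sub (Sub.trans (sub_of_mem_parts _ hb) (sub_of_mem_parts t₀ hM))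
  exact hab.mono (inter_subset_inter (zf_zoneP_subset _ _ _ p) (zf_zoneP_subset _ _ _ p))

/-! ## §2 Bookkeeping: sub-structures of joins and parts, datings, renewals -/

section Book

variable {ε : Type*} (st : ε → ℕ)

/-- cluster parts are sub-structures [folklore] -/
theorem sub_of_mem_clusterParts (t : ℕ) : ∀ (G : Gen ε), ∀ q ∈ clusterParts st t G, Sub q.2 G
  | Gen.born b j, q, hq => by
      rw [clusterParts_born, List.mem_singleton] at hq; subst hq; exact Sub.refl _
  | Gen.renew G e h, q, hq => by
      rw [clusterParts_renew, List.mem_singleton] at hq; subst hq; exact Sub.refl _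
  | Gen.merge X Y e, q, hq => by
      by_cases he : st e = t
      · rw [clusterParts_merge_of_eq st he, List.mem_append, List.mem_map, List.mem_map] at hq
        rcases hq with ⟨q', hq', rfl⟩ | ⟨q', hq', rfl⟩
        · exact Sub.left Y e (sub_of_mem_clusterParts t X q' hq')
        · exact Sub.right X e (sub_of_mem_clusterParts t Y q' hq')
      · rw [clusterParts_merge_of_ne st he, List.mem_singleton] at hq
        subst hq; exact Sub.refl _

/-- joins are sub-structures [folklore] -/
theorem sub_of_mem_crootsP : ∀ (o : Option ℕ) (G : Gen ε), ∀ q ∈ crootsP st o G, Sub q.2 G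
  | o, Gen.born b j, q, hq => by simp [crootsP] at hq
  | o, Gen.renew G e h, q, hq => Sub.renew e h (sub_of_mem_crootsP none G q hq)
  | o, Gen.merge X Y e, q, hq => by
      simp only [crootsP, List.mem_append, List.mem_map] at hq
      rcases hq with hq | ⟨q', hq', rfl⟩ | ⟨q', hq', rfl⟩
      · split_ifs at hq with hp
        · simp at hq
        · rw [List.mem_singleton] at hq; subst hq; exact Sub.refl _
      · exact Sub.left Y e (sub_of_mem_crootsP _ X q' hq')
      · exact Sub.right X e (sub_of_mem_crootsP _ Y q' hq')

variable {st}

/-- a join of `G` is a sub-structure of `G` [folklore] -/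
theorem sub_of_mem_joins {G X : Gen ε} (hX : X ∈ joins st G) : Sub X G := by
  unfold joins croots at hX
  obtain ⟨q, hq, rfl⟩ := List.mem_map.1 hX
  exact sub_of_mem_crootsP st none G q hq

/-- a part of the top join is a sub-structure [folklore] -/
theorem sub_of_mem_tparts {X P : Gen ε} (hP : P ∈ tparts st X) : Sub P X := by
  unfold tparts at hP
  obtain ⟨q, hq, rfl⟩ := List.mem_map.1 hP
  cases X with
  | born b j => simp [jparts] at hq
  | renew Y e h => simp [jparts] at hq
  | merge A B e => exact sub_of_mem_clusterParts st (st e) _ q hq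

/-- a sub-structure of a dated structure is dated [folklore] -/
theorem dated_of_sub {W : Gen ε} {G : Gen ε} {s : Bool} {t : ℕ} (hD : Dated st s t G) (hS : Sub W G) :
    ∃ s' t', Dated st s' t' W := by
  induction hS generalizing s t with
  | refl => exact ⟨s, t, hD⟩
  | renew e' h' _ ih => rw [dated_renew] at hD; exact ih hD
  | left B' e' _ ih => rw [dated_merge] at hD; exact ih hD.2.2.1
  | right A' e' _ ih => rw [dated_merge] at hD; exact ih hD.2.2.2

/-- a merge node of a structure dated at `t` happens no later than `t`, strictly earlier under a strict dating
[folklore] -/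
theorem step_le_of_dated_sub {Y Z : Gen ε} {e : ε} {G : Gen ε} {s : Bool} {t : ℕ} (hD : Dated st s t G)
    (hS : Sub (Gen.merge Y Z e) G) : st e ≤ t ∧ (s = true → st e < t) := by
  induction hS generalizing s t with
  | refl => rw [dated_merge] at hD; exact ⟨hD.1, hD.2.1⟩
  | renew e' h' _ ih =>
      rw [dated_renew] at hD
      have h := ih hD
      exact ⟨h.1, fun _ => h.2 rfl⟩
  | left B' e' _ ih =>
      rw [dated_merge] at hD
      have h := ih hD.2.2.1
      exact ⟨h.1.trans hD.1, fun hs => lt_of_le_of_lt h.1 (hD.2.1 hs)⟩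
  | right A' e' _ ih =>
      rw [dated_merge] at hD
      have h := ih hD.2.2.2
      exact ⟨h.1.trans hD.1, fun hs => lt_of_le_of_lt h.1 (hD.2.1 hs)⟩

end Book

omit [LinearOrder R] in
/-- the canonically admissible junk placements of a renewal are those of the renewed structure [folklore] -/
theorem sany_renew [LinearOrder R] (zone : ℕ → Gen PEv → (Addr D → TCell d (n * L ^ K) × Template d M) →
    Finset (Fin d → ℕ)) (Y : Gen PEv) (e : PEv) (h : ℕ) :
    Sany zone ρ c₀ PEv.step (Gen.renew Y e h) = Sany zone ρ c₀ PEv.step Y := by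
  ext q
  simp only [mem_Sany, cadm_renew]
  exact Iff.rfl

/-- the side conditions are renewal-blind [folklore] -/
theorem ok_renew_iff (Z : Gen PEv) (e : PEv) (h : ℕ) :
    OK n L K lv c₀ p (Gen.renew Z e h) ↔ OK n L K lv c₀ p Z := by
  simp only [OK, addrTag_renew, births_renew, Gen.rootStep_renew, rootAddr]

/-! ## §3 The root block lies in the zone -/

/-- residues of small naturals [folklore] -/
theorem res_natCast_of_lt {m k : ℕ} (h : k < m) : res m (k : ℤ) = k := by
  unfold res
  rw [Int.emod_eq_of_lt (by positivity) (by exact_mod_cast h), Int.toNat_natCast]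

/-- **THE ANCHOR BLOCK LIES IN THE REGION**: the level block of the anchor cell is a cell of the (reduced, translated)
template — templates contain the origin. [folklore] -/
theorem blk_mem_regOf (hL : 1 ≤ L) (ab : List Bool × PEv) (h : lv ab.2.step ≤ K) :
    blk L (lv ab.2.step) (evalA c₀ p ab.1).1 ∈ regOf n L K lv c₀ p ab := by
  unfold regOf redZone
  refine mem_image.2 ⟨anchorZ L lv (evalA c₀ p ab.1).1 ab.2.step, mem_translate_self _ _, funext fun i => ?_⟩
  simp only [anchorZ]
  apply res_natCast_of_lt
  simp only [blk]
  rw [Nat.div_lt_iff_lt_mul (pow_pos (by omega) _), mul_assoc, ← pow_add, Nat.sub_add_cancel h]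
  exact ((evalA c₀ p ab.1).1 i).isLt

/-- **THE ROOT CELL's LEVEL-`t` BLOCK LIES IN THE REGION READING** at every step `t ≥ ftime` with `lv t ≤ K`, for a
chronological structure. [folklore] -/
theorem root_blk_mem_regZoneD (hL : 1 ≤ L) (hn : 1 ≤ n) (hlv : LevelFn K lv) {P : Gen PEv}
    (hchr : Chrono PEv.step P) {t : ℕ} (hft : ftime PEv.step P ≤ t) (htK : lv t ≤ K) :
    blk L (lv t) (evalA c₀ p (rootAddr P)).1 ∈
      regZoneD Prod.snd n L K lv c (regOf n L K lv c₀ p) t (addrTag [] P) := by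
  have hb := root_mem_births_addrTag P
  have hle : (P.root).step ≤ t := (step_le_ftime_of_chrono hchr P.root (root_mem_births P)).trans hft
  have hlvle : lv (P.root).step ≤ lv t := hlv.monotone hle
  have hrange : ∀ b ∈ births (addrTag [] P), InRange (n * L ^ (K - lv (Prod.snd b).step)) (regOf n L K lv c₀ p b) :=
    fun b _ => regOf_inRange hL hn b
  unfold regZoneD
  refine subset_thickT c (inRange_coreZoneD' (sh := Prod.snd) hL hlv hrange (Sub.refl _) t)
    (mem_coreZoneD.2 ⟨(rootAddr P, P.root), hb, hle, ?_⟩)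
  have heq : blk L (lv t) (evalA c₀ p (rootAddr P)).1 =
      blockVec (L ^ (lv t - lv (P.root).step)) (blk L (lv (P.root).step) (evalA c₀ p (rootAddr P)).1) := by
    funext i
    simp only [blk, blockVec]
    rw [Nat.div_div_eq_div_mul, ← pow_add, Nat.add_sub_cancel' hlvle]
  rw [heq]
  exact blockVec_mem_blocks _ (blk_mem_regOf hL (rootAddr P, P.root) (hlvle.trans htK))

end

end Summit.QuantumFields.BalabanUV.T4Continuum.HistoryJoinsPlacedTagged
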